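import Mathlib

/-!
# The linearised lift-off layer — kernel #127 (solo-blind s73)

Hypothesis (T3) of the reduced existence theorem (paper 24.68(3)) is re-typed in paper 24.80:
at `n = ∞` the lift-off layer consists of the EXPLICIT pair of kernel #111 on the smoothing
scale `ℓ` (`Q₀ = (η³+3η-4)₊`, `m₀ = 6 min(1,e^{η-1})`) and, in the sub-layer
`η - 1 = ε^{1/3} ξ`, of the Hastings–McLeod solution of Painlevé II (kernel #117).  This file
certifies the LINEAR facts that discharge (T3) without a validated-numerics certificate.

* `ℓ`-scale ("invertible modulo translation"): the translation family
  `Q_c(η) = (η-c)³ + 3(η-c)² + 6(η-c)` exports the far field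
  `η³ + c₂η² + c₁η + c₀` with `(c₁, c₀) = (3 + c₂²/3, -4 + c₂ + c₂³/27)` a GRAPH over the
  `η²`-coefficient `c₂ = 3 - 3c`: one far-field datum fixes the translation, the other two
  coefficients are outputs, with linear response `(δc₁, δc₀) = (0, 1)·δc₂` at the design contact;
  the translation mode is `∂_s Q₀(η - s) = -(3(η-s)² + 3)`.
* sub-layer: the Gateaux derivative of `N(A, p) = A'' + ((p - A²)/6)·A` is
  `δA ↦ δA'' + ((p - 3A²)/6)·δA`, `δp ↦ (A/6)·δp`; under `A(ξ) = √12·u(-ξ)`, `p = 6ξ` the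
  potential is `-(x + 6u(x)²)`, `x = -ξ`: the sub-layer block is (minus) the linearised
  Hastings–McLeod operator `-∂ₓ² + x + 6u²`, whose potential is positive on `ℝ`
  (Gallo–Pelinovsky, Asymptot. Anal. 73 (2011); Karali–Sourdis, ARMA 217 (2015) Prop. 1:
  `3V² + x ≥ c > 0` with `V = √2·u`).
* NON-DEGENERACY FROM A POSITIVE POTENTIAL: if `v'' = V·v` on `ℝ` with `V > 0` pointwise and
  `v` bounded then `v ≡ 0` (`v²` is convex and bounded, hence has identically vanishing
  derivative).  So the sub-layer block has no bounded kernel and — Painlevé II being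
  non-autonomous — no translation mode: the junction is non-degenerate.
-/

namespace Summit.AnomalousDissipation.AnomalousDissipation.Theorems

open Real Set

/-! ## The `ℓ`-scale translation family and its far-field graph -/

/-- the translation family written over its `η²`-coefficient `c₂` (contact at `c = 1 - c₂/3`):
far field `η³ + c₂η² + (3 + c₂²/3)η + (-4 + c₂ + c₂³/27)`. -/
theorem liftoff_family_farfield (c₂ η : ℝ) :
    (η - (1 - c₂ / 3)) ^ 3 + 3 * (η - (1 - c₂ / 3)) ^ 2 + 6 * (η - (1 - c₂ / 3))
      = η ^ 3 + c₂ * η ^ 2 + (3 + c₂ ^ 2 / 3) * η + (-4 + c₂ + c₂ ^ 3 / 27) := by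
  ring

/-- the contact position as a function of the far-field datum: `c = 1 - c₂/3`, i.e.
`c₂ = 3 - 3c` (kernel #111 `liftoff_contact_unique` is the case `c₂ = 0`). -/
theorem liftoff_contact_of_datum (c c₂ : ℝ) : c₂ = 3 - 3 * c ↔ c = 1 - c₂ / 3 := by
  constructor <;> intro h <;> linarith

/-- the exported `η`-coefficient `c₁ = 3 + c₂²/3` is stationary at the design contact:
`δc₁ = 0·δc₂`. -/
theorem liftoff_family_c1_hasDerivAt :
    HasDerivAt (fun c₂ : ℝ => 3 + c₂ ^ 2 / 3) 0 0 := by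
  have h := ((hasDerivAt_pow 2 (0:ℝ)).div_const 3).const_add 3
  simpa using h

/-- the exported constant `c₀ = -4 + c₂ + c₂³/27` responds one-to-one: `δc₀ = 1·δc₂`. -/
theorem liftoff_family_c0_hasDerivAt :
    HasDerivAt (fun c₂ : ℝ => -4 + c₂ + c₂ ^ 3 / 27) 1 0 := by
  have h := ((hasDerivAt_const (0:ℝ) (-4:ℝ)).fun_add (hasDerivAt_id' (0:ℝ))).fun_add
    ((hasDerivAt_pow 3 (0:ℝ)).div_const 27)
  have e : (0:ℝ) + 1 + (↑(3:ℕ) * (0:ℝ) ^ (3 - 1)) / 27 = 1 := by norm_num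
  rw [e] at h
  exact h

/-- `c₁ ≥ 3` along the whole family, with equality exactly at the design contact `c₂ = 0`. -/
theorem liftoff_family_c1_ge (c₂ : ℝ) : 3 ≤ 3 + c₂ ^ 2 / 3 := by
  have := sq_nonneg c₂; linarith

/-- … and `c₁ = 3` singles out the design contact `c₂ = 0`. -/
theorem liftoff_family_c1_eq_iff (c₂ : ℝ) : 3 + c₂ ^ 2 / 3 = 3 ↔ c₂ = 0 := by
  constructor
  · intro h
    have : c₂ ^ 2 = 0 := by linarith
    exact pow_eq_zero_iff (n := 2) (by norm_num) |>.mp this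
  · intro h; subst h; ring

/-- the translation mode of the `ℓ`-scale layer: `∂_s [(η-s)³ + 3(η-s) - 4] = -(3(η-s)² + 3)`. -/
theorem liftoff_translation_mode (η s : ℝ) :
    HasDerivAt (fun s : ℝ => (η - s) ^ 3 + 3 * (η - s) - 4) (-(3 * (η - s) ^ 2 + 3)) s := by
  have h1 : HasDerivAt (fun s : ℝ => η - s) (-1) s := (hasDerivAt_id' s).const_sub η
  have h := ((h1.fun_pow 3).fun_add (h1.const_mul 3)).sub_const 4
  have e : (↑(3:ℕ) : ℝ) * (η - s) ^ (3 - 1) * (-1) + 3 * (-1) = -(3 * (η - s) ^ 2 + 3) := by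
    norm_num
    ring
  rw [e] at h
  exact h

/-- the translation mode does not vanish anywhere (`3(η-s)²+3 ≥ 3`): the `ℓ`-scale kernel is
exactly one-dimensional and is removed by ONE scalar condition. -/
theorem liftoff_translation_mode_ne_zero (η s : ℝ) : -(3 * (η - s) ^ 2 + 3) ≠ 0 := by
  have := sq_nonneg (η - s); intro h; linarith

/-! ## The sub-layer block is the linearised Hastings–McLeod operator -/

/-- Gateaux derivative of `N(A,p) = A'' + ((p - A²)/6)·A` in the direction `δA`
(values `δ`, `δ''`): `δ'' + ((p - 3A²)/6)·δ`. -/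
theorem sublayer_gateaux_A (A A'' δ δ'' p : ℝ) :
    HasDerivAt (fun t : ℝ => (A'' + t * δ'') + ((p - (A + t * δ) ^ 2) / 6) * (A + t * δ))
      (δ'' + ((p - 3 * A ^ 2) / 6) * δ) 0 := by
  have hlin : HasDerivAt (fun t : ℝ => A + t * δ) δ 0 := by
    simpa using ((hasDerivAt_id (0:ℝ)).mul_const δ).const_add A
  have h1 : HasDerivAt (fun t : ℝ => A'' + t * δ'') δ'' 0 := by
    simpa using ((hasDerivAt_id (0:ℝ)).mul_const δ'').const_add A''
  have h2 : HasDerivAt (fun t : ℝ => (p - (A + t * δ) ^ 2) / 6)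
      ((0 - (↑(2:ℕ) * (A + 0 * δ) ^ (2 - 1) * δ)) / 6) 0 :=
    ((hasDerivAt_const (0:ℝ) p).fun_sub (hlin.fun_pow 2)).div_const 6
  have h := h1.fun_add (h2.fun_mul hlin)
  have e : δ'' + ((0 - (↑(2:ℕ) * (A + 0 * δ) ^ (2 - 1) * δ)) / 6 * (A + 0 * δ)
      + (p - (A + 0 * δ) ^ 2) / 6 * δ) = δ'' + ((p - 3 * A ^ 2) / 6) * δ := by
    norm_num; ring
  rw [e] at h
  exact h

/-- Gateaux derivative of `N(A,p)` in the direction `δp` of the quadratic gauge `p`: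
`(A/6)·δp` — the contact displacement enters the sub-layer as a FORCING, not as a kernel
vector. -/
theorem sublayer_gateaux_p (A A'' p δp : ℝ) :
    HasDerivAt (fun t : ℝ => A'' + ((p + t * δp - A ^ 2) / 6) * A) ((A / 6) * δp) 0 := by
  have hlin : HasDerivAt (fun t : ℝ => p + t * δp - A ^ 2) δp 0 := by
    simpa using (((hasDerivAt_id (0:ℝ)).mul_const δp).const_add p).sub_const (A ^ 2)
  have h := ((hlin.div_const 6).mul_const A).const_add A''
  have e : δp / 6 * A = (A / 6) * δp := by ring
  rw [e] at h
  exact h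

/-- the potential of the sub-layer block at `p = 6ξ`, `A = √12·U`, read at `x = -ξ`:
`(6ξ - 3A²)/6 = -(x + 6U²)`. -/
theorem sublayer_potential (U x : ℝ) :
    (6 * (-x) - 3 * (sqrt 12 * U) ^ 2) / 6 = -(x + 6 * U ^ 2) := by
  have h12 : sqrt 12 ^ 2 = 12 := Real.sq_sqrt (by norm_num)
  rw [mul_pow, h12]; ring

/-- REFLECTION: if `δA(ξ) = v(-ξ)` then `δA''(ξ) = v''(-ξ)` (two sign flips). -/
theorem sublayer_reflect_second {v v' v'' : ℝ → ℝ} (hv : ∀ x, HasDerivAt v (v' x) x)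
    (hv' : ∀ x, HasDerivAt v' (v'' x) x) (ξ : ℝ) :
    HasDerivAt (fun y : ℝ => v (-y)) (-(v' (-ξ))) ξ ∧
    HasDerivAt (fun y : ℝ => -(v' (-y))) (v'' (-ξ)) ξ := by
  constructor
  · have h := (hv (-ξ)).comp ξ (hasDerivAt_neg ξ)
    have e : v' (-ξ) * -1 = -(v' (-ξ)) := by ring
    rw [e] at h; exact h
  · have h := ((hv' (-ξ)).comp ξ (hasDerivAt_neg ξ)).neg
    have e : -(v'' (-ξ) * -1) = v'' (-ξ) := by ring
    rw [e] at h; exact h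

/-- the sub-layer block applied to a reflected function is MINUS the linearised Hastings–McLeod
operator: `δA'' + ((6ξ - 3A²)/6)δA = -( -v'' + (x + 6u²)v )` at `x = -ξ`. -/
theorem sublayer_block_eq_neg_hm (u v v'' : ℝ → ℝ) (ξ : ℝ) :
    v'' (-ξ) + ((6 * ξ - 3 * (sqrt 12 * u (-ξ)) ^ 2) / 6) * v (-ξ)
      = -(-(v'' (-ξ)) + ((-ξ) + 6 * (u (-ξ)) ^ 2) * v (-ξ)) := by
  have h := sublayer_potential (u (-ξ)) (-ξ)
  rw [neg_neg] at h
  rw [h]; ring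

/-! ## Non-degeneracy from a positive potential -/

/-- ONE-SIDED GROWTH (right): if `deriv w ≥ C > 0` on `(a, ∞)` then `w` is unbounded above —
quantitatively `C·t ≤ w(a+t) - w(a)` for `t ≥ 0`. -/
theorem growth_right {w : ℝ → ℝ} (hw : Differentiable ℝ w) {a C : ℝ}
    (hC : ∀ x, a < x → C ≤ deriv w x) {t : ℝ} (ht : 0 ≤ t) :
    C * t ≤ w (a + t) - w a := by
  have key := (convex_Ici a).mul_sub_le_image_sub_of_le_deriv hw.continuous.continuousOn
    (hw.differentiableOn) (fun x hx => hC x (by simpa [interior_Ici] using hx))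
    a self_mem_Ici (a + t) (by simp [ht]) (by linarith)
  simpa using key

/-- ONE-SIDED GROWTH (left): if `deriv w ≤ C < 0` on `(-∞, a)` then `-C·t ≤ w(a-t) - w(a)` for
`t ≥ 0`. -/
theorem growth_left {w : ℝ → ℝ} (hw : Differentiable ℝ w) {a C : ℝ}
    (hC : ∀ x, x < a → deriv w x ≤ C) {t : ℝ} (ht : 0 ≤ t) :
    -C * t ≤ w (a - t) - w a := by
  have key := (convex_Iic a).image_sub_le_mul_sub_of_deriv_le hw.continuous.continuousOn
    (hw.differentiableOn) (fun x hx => hC x (by simpa [interior_Iic] using hx))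
    (a - t) (by simp [ht]) a self_mem_Iic (by linarith)
  have e : C * (a - (a - t)) = C * t := by ring
  rw [e] at key
  linarith

/-- A BOUNDED FUNCTION WITH MONOTONE DERIVATIVE HAS ZERO DERIVATIVE. -/
theorem deriv_eq_zero_of_bounded_of_monotone_deriv {w w' : ℝ → ℝ}
    (hw : ∀ x, HasDerivAt w (w' x) x) (hmono : Monotone w') {B : ℝ}
    (hB : ∀ x, |w x| ≤ B) : ∀ a, w' a = 0 := by
  have hdiff : Differentiable ℝ w := fun x => (hw x).differentiableAt
  have hderiv : ∀ x, deriv w x = w' x := fun x => (hw x).deriv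
  have hosc : ∀ x y, w y - w x ≤ 2 * B := by
    intro x y
    have h1 := (abs_le.mp (hB y)).2
    have h2 := (abs_le.mp (hB x)).1
    linarith
  have hBnn : 0 ≤ B := le_trans (abs_nonneg _) (hB 0)
  intro a
  by_contra hne
  rcases lt_or_gt_of_ne hne with hneg | hpos
  · -- `w' a < 0`: growth to the left
    set t : ℝ := (2 * B + 1) / (-(w' a)) with ht_def
    have ht : 0 ≤ t := by rw [ht_def]; exact div_nonneg (by linarith) (by linarith)
    have hg := growth_left hdiff (a := a) (C := w' a)
      (fun x hx => by rw [hderiv]; exact hmono hx.le) ht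
    have e : -(w' a) * t = 2 * B + 1 := by
      rw [ht_def]; field_simp
    have := hosc a (a - t)
    linarith
  · -- `w' a > 0`: growth to the right
    set t : ℝ := (2 * B + 1) / (w' a) with ht_def
    have ht : 0 ≤ t := by rw [ht_def]; exact div_nonneg (by linarith) hpos.le
    have hg := growth_right hdiff (a := a) (C := w' a)
      (fun x hx => by rw [hderiv]; exact hmono hx.le) ht
    have e : (w' a) * t = 2 * B + 1 := by
      rw [ht_def]; field_simp
    have := hosc a (a + t)
    linarith

/-- NON-DEGENERACY FROM A POSITIVE POTENTIAL. If `v'' = V·v` on `ℝ` with `V > 0` pointwise and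
`v` bounded, then `v ≡ 0`: `w = v²` has `w' = 2vv'` and `w'' = 2v'² + 2Vv² ≥ 0`, so `w'` is
monotone; a bounded `w` then has `w' ≡ 0`, hence `w'' ≡ 0`, hence `V v² = 0`. -/
theorem no_bounded_kernel_of_pos_potential {V v v' : ℝ → ℝ}
    (hv : ∀ x, HasDerivAt v (v' x) x) (hv' : ∀ x, HasDerivAt v' (V x * v x) x)
    (hV : ∀ x, 0 < V x) (hb : ∃ B, ∀ x, |v x| ≤ B) : ∀ x, v x = 0 := by
  obtain ⟨B, hB⟩ := hb
  -- w = v², w' = 2 v v'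
  have hw : ∀ x, HasDerivAt (fun y => v y ^ 2) (2 * (v x * v' x)) x := by
    intro x
    have h := (hv x).fun_pow 2
    have e2 : (↑(2:ℕ) : ℝ) * v x ^ (2 - 1) * v' x = 2 * (v x * v' x) := by
      norm_num
      ring
    rw [e2] at h; exact h
  -- w'' = 2 v'² + 2 V v²
  have hw' : ∀ x, HasDerivAt (fun y => 2 * (v y * v' y)) (2 * v' x ^ 2 + 2 * V x * v x ^ 2) x := by
    intro x
    have h := ((hv x).fun_mul (hv' x)).const_mul 2
    have e2 : 2 * (v' x * v' x + v x * (V x * v x)) = 2 * v' x ^ 2 + 2 * V x * v x ^ 2 := by ring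
    rw [e2] at h; exact h
  have hdiff' : Differentiable ℝ (fun y => 2 * (v y * v' y)) := fun x => (hw' x).differentiableAt
  have hmono : Monotone (fun y => 2 * (v y * v' y)) := by
    apply monotone_of_deriv_nonneg hdiff'
    intro x
    rw [(hw' x).deriv]
    have h1 : 0 ≤ 2 * v' x ^ 2 := by positivity
    have h2 : 0 ≤ 2 * V x * v x ^ 2 := mul_nonneg (mul_nonneg (by norm_num) (hV x).le) (sq_nonneg _)
    linarith
  have hwB : ∀ x, |v x ^ 2| ≤ B ^ 2 := by
    intro x
    rw [abs_of_nonneg (sq_nonneg _), ← sq_abs]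
    exact pow_le_pow_left₀ (abs_nonneg _) (hB x) 2
  have hzero := deriv_eq_zero_of_bounded_of_monotone_deriv hw hmono hwB
  -- w' ≡ 0 ⇒ w'' ≡ 0 ⇒ V v² = 0
  intro x
  have hconst : HasDerivAt (fun y => 2 * (v y * v' y)) 0 x := by
    have e : (fun y => 2 * (v y * v' y)) = fun _ => (0:ℝ) := by funext y; exact hzero y
    rw [e]; exact hasDerivAt_const x 0
  have huniq : 2 * v' x ^ 2 + 2 * V x * v x ^ 2 = 0 := (hw' x).unique hconst
  have h1 : 0 ≤ 2 * v' x ^ 2 := by positivity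
  have h2 : 0 ≤ 2 * V x * v x ^ 2 := mul_nonneg (mul_nonneg (by norm_num) (hV x).le) (sq_nonneg _)
  have h3 : 2 * V x * v x ^ 2 = 0 := by linarith
  have h4 : v x ^ 2 = 0 := by
    rcases mul_eq_zero.mp h3 with h | h
    · exfalso; have := hV x; linarith
    · exact h
  exact pow_eq_zero_iff (n := 2) (by norm_num) |>.mp h4

/-- THE HASTINGS–McLEOD JUNCTION IS NON-DEGENERATE. With the Gallo–Pelinovsky / Karali–Sourdis
positivity of the linearised potential `x + 6u(x)²` (their `3V² + x ≥ c > 0`, `V = √2 u`) as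
hypothesis, every bounded solution of the linearised Painlevé-II equation `v'' = (x + 6u²)·v`
vanishes identically: the sub-layer block of the lift-off layer has no bounded kernel. -/
theorem hm_linearisation_nondegenerate {u v v' : ℝ → ℝ}
    (hpos : ∀ x, 0 < x + 6 * u x ^ 2)
    (hv : ∀ x, HasDerivAt v (v' x) x) (hv' : ∀ x, HasDerivAt v' ((x + 6 * u x ^ 2) * v x) x)
    (hb : ∃ B, ∀ x, |v x| ≤ B) : ∀ x, v x = 0 :=
  no_bounded_kernel_of_pos_potential (V := fun x => x + 6 * u x ^ 2) hv hv' hpos hb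

/-- conversely the positivity hypothesis is not vacuous where it matters: far upstream the
Hastings–McLeod far field `6u² = -3x - (3/4)x⁻² + …` makes the potential `-2x - (3/4)x⁻² + …`,
and already its two-term truncation is positive for `x ≤ -1`. -/
theorem hm_potential_far_left {x : ℝ} (hx : x ≤ -1) : 0 < -2 * x - 3 / (4 * x ^ 2) := by
  have hx2 : 1 ≤ x ^ 2 := by nlinarith
  have h1 : 3 / (4 * x ^ 2) ≤ 3 / 4 := by
    apply div_le_div_of_nonneg_left (by norm_num) (by norm_num) (by nlinarith)
  linarith

end Summit.AnomalousDissipation.AnomalousDissipation.Theorems
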